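import Summits.AtomisticToContinuum.Crystallization.Theorems.FrustratedLawDichotomyTwoShellRigidityGaugedLadderB

/-!
# PART C of lens-5 g32 `TwoShellRigidityGaugedLadder.lean` (sha256 7a91fe068329bbfb…; module docstring of record in PART A)

§4 glue (chains of rungs / LPs, terminal conversion to `M` / `M⁺`), §5 the entry side (ungauged fits from the hand lane, the ONE re-gauging step, `GaugeFix`).
(Split A → B → C → D for the 400-line rule by prover hand 1, gen 11, --supports stmt-AtomisticToContinuum-27623; declarations byte-identical; gate-forced delta: docstrings on undocumented helper lemmas.)
-/

noncomputable section

namespace Summit.AtomisticToContinuum.Crystallization.Theorems.FrustratedLawDichotomyTwoShellRigidityGaugedLadder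


open Literature.Geometry.DiscreteGeometry
open Summit.AtomisticToContinuum.Crystallization.Theorems.FrustratedLawDichotomyTwoShellRigidityCut
open Summit.AtomisticToContinuum.Crystallization.Theorems.FrustratedLawDichotomyTwoShellRigidityCells
open Summit.AtomisticToContinuum.Crystallization.Theorems.FrustratedLawDichotomyBondGraphWindows
open Summit.AtomisticToContinuum.Crystallization.Theorems.FrustratedLawDichotomyTwoShellRigidityLadder (CapAprioriAt)
open Summit.AtomisticToContinuum.Crystallization.Theorems.FrustratedLawDichotomyTwoShellRigidityLadderCap
  (capAprioriAt_fcc capAprioriAt_hcp capAprioriAt_trilateration_fcc capAprioriAt_trilateration_hcp)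
open Summit.AtomisticToContinuum.Crystallization.Theorems.FrustratedLawDichotomyTwoShellRigidityProbeCovering (covers_probes26)
open scoped RealInnerProductSpace

/-! ## 4. Glue: chains of rungs, chains of LPs, and the terminal conversion to `M` / `M⁺` -/

/-- A chain applied: `GChain(P → L → Q)` turns a gauged fit of tolerance `P` into one of tolerance `Q`, same isometry. [folklore] -/
theorem gChainAt_apply {Pat : Finset E3} {D : List E3} {Γ : (↥Pat → E3) → Prop} {θ : ℝ} :
    ∀ (L : List (ℝ × ℝ × ℝ × ℝ)) {P Q : ℝ × ℝ × ℝ × ℝ}, GChainAt Pat D Γ θ P L Q →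
      ∀ {N : ℕ} (y : Fin N → E3) (i : Fin N) (τ : ↥Pat → Fin N), Function.Injective y →
        (∀ a b : Fin N, a ≠ b → (7 : ℝ) / 10 ≤ dist (y a) (y b)) → LinkIso θ Pat y i τ → Capped θ Pat y i τ →
          ∀ A : E3 ≃ₗᵢ[ℝ] E3, GFitAt Pat D Γ θ P y i τ A → GFitAt Pat D Γ θ Q y i τ A
  | [], _, _, h, _, y, i, τ, hy, hsep, hL, hC, A, hA => h _ y i τ hy hsep hL hC A hA
  | _ :: L, _, _, h, _, y, i, τ, hy, hsep, hL, hC, A, hA =>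
      gChainAt_apply L h.2 y i τ hy hsep hL hC A (h.1 _ y i τ hy hsep hL hC A hA)

/-- Entry + chain = entry at the terminal tolerance. [folklore] -/
theorem gEntryAt_of_gChain {Pat : Finset E3} {D : List E3} {Γ : (↥Pat → E3) → Prop} {θ : ℝ} {P Q : ℝ × ℝ × ℝ × ℝ}
    {L : List (ℝ × ℝ × ℝ × ℝ)} (hE : GEntryAt Pat D Γ θ P) (hC : GChainAt Pat D Γ θ P L Q) : GEntryAt Pat D Γ θ Q := by
  intro N y i τ hy hsep hL hC'
  obtain ⟨A, hA⟩ := hE N y i τ hy hsep hL hC'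
  exact ⟨A, gChainAt_apply L hC y i τ hy hsep hL hC' A hA⟩

/-- A chain of finite LPs `RungLP(P → R₁), RungLP(R₁ → R₂), …, RungLP(R_k → Q)` in one currency `(D, Γ, θ, ρ)`. -/
def RungLPChain (Pat : Finset E3) (D : List E3) (Γ : (↥Pat → E3) → Prop) (θ ρ : ℝ) :
    ℝ × ℝ × ℝ × ℝ → List (ℝ × ℝ × ℝ × ℝ) → ℝ × ℝ × ℝ × ℝ → Prop
  | P, [], Q => RungLP Pat D D Γ θ ρ P Q
  | P, R :: L, Q => RungLP Pat D D Γ θ ρ P R ∧ RungLPChain Pat D Γ θ ρ R L Q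

/-- ★ applied along a chain: `RungLPChain ⟹ GChain`. [folklore] -/
theorem gChainAt_of_rungLPChain {Pat : Finset E3} {D : List E3} {Γ : (↥Pat → E3) → Prop} {θ ρ : ℝ}
    (h1 : ∀ z ∈ Pat, ‖z‖ = 1) (hθ : 0 ≤ θ) (hρ : 0 ≤ ρ) (hcov : Covers D ρ) :
    ∀ (L : List (ℝ × ℝ × ℝ × ℝ)) {P Q : ℝ × ℝ × ℝ × ℝ}, RungLPChain Pat D Γ θ ρ P L Q → GChainAt Pat D Γ θ P L Q
  | [], _, _, h => gRungAt_of_rungLP h1 hθ hρ hcov h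
  | _ :: L, _, _, h => ⟨gRungAt_of_rungLP h1 hθ hρ hcov h.1, gChainAt_of_rungLPChain h1 hθ hρ hcov L h.2⟩

/-- Reading a frame residual back in the laboratory: `(y j − y i) − nn_i·A z = nn_i · A(resAt y i A j z)`. [folklore] -/
theorem sub_smul_eq_smul_res {N : ℕ} (y : Fin N → E3) (i : Fin N) (A : E3 ≃ₗᵢ[ℝ] E3) (hr : 0 < nearestDist y i)
    (j : Fin N) (z : E3) : (y j - y i) - nearestDist y i • A z = nearestDist y i • A (resAt y i A j z) := by
  simp only [resAt, map_sub, LinearIsometryEquiv.apply_symm_apply, map_smul, smul_sub, smul_smul,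
    mul_inv_cancel₀ hr.ne', one_smul]

/-- `‖(y j − y i) − nn_i·A z‖ = nn_i · ‖resAt y i A j z‖` (the residual read in the pattern frame, rescaled). [folklore] -/
theorem norm_sub_smul_eq {N : ℕ} (y : Fin N → E3) (i : Fin N) (A : E3 ≃ₗᵢ[ℝ] E3) (hr : 0 < nearestDist y i)
    (j : Fin N) (z : E3) : ‖(y j - y i) - nearestDist y i • A z‖ = nearestDist y i * ‖resAt y i A j z‖ := by
  rw [sub_smul_eq_smul_res y i A hr j z, norm_smul, LinearIsometryEquiv.norm_map, Real.norm_of_nonneg hr.le]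

/-- **TERMINAL CONVERSION to `M` at one pattern**: a gauged `D`-entry of tolerance `Q` with `ρ·Q.1 < η` (`ρ` the covering constant of `D`)
IS `CappedRigidityAt θ η Pat`. [folklore] -/
theorem cappedRigidityAt_of_gEntry {Pat : Finset E3} {D : List E3} {Γ : (↥Pat → E3) → Prop} {θ ρ η : ℝ} {Q : ℝ × ℝ × ℝ × ℝ}
    (hρ : 0 ≤ ρ) (hcov : Covers D ρ) (hE : GEntryAt Pat D Γ θ Q) (hη : ρ * Q.1 < η) : CappedRigidityAt θ η Pat := by
  intro N y i τ hy hsep hL hC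
  obtain ⟨A, hf1, -, -, -, -⟩ := hE N y i τ hy hsep hL hC
  refine ⟨ρ * Q.1, A.toLinearIsometry, hη, fun u => ?_⟩
  have hr : 0 < nearestDist y i := nearestDist_pos_of_adj hy (hL.1 u)
  have hres : ‖resAt y i A (τ u) u‖ ≤ ρ * Q.1 := norm_le_of_covers hρ hcov fun n hn => hf1 n hn u
  rw [LinearIsometryEquiv.coe_toLinearIsometry, norm_sub_smul_eq y i A hr, mul_comm]
  exact mul_le_mul_of_nonneg_right hres hr.le

/-- **TERMINAL CONVERSION to `M⁺` (lens-4's `CappedRigidityBothAt`)**: dozen within `ρ·Q.1`, caps within `ρ·Q.2.1`. [folklore] -/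
theorem cappedRigidityBothAt_of_gEntry {Pat : Finset E3} {D : List E3} {Γ : (↥Pat → E3) → Prop} {θ ρ : ℝ} {Q : ℝ × ℝ × ℝ × ℝ}
    (hρ : 0 ≤ ρ) (hcov : Covers D ρ) (hE : GEntryAt Pat D Γ θ Q) : CappedRigidityBothAt θ (ρ * Q.1) (ρ * Q.2.1) Pat := by
  intro N y i τ hy hsep hL hC
  obtain ⟨A, hf1, hf2, -, -, -⟩ := hE N y i τ hy hsep hL hC
  refine ⟨A.toLinearIsometry, fun u => ?_, fun u v m huv hmi hb => ?_⟩
  · have hr : 0 < nearestDist y i := nearestDist_pos_of_adj hy (hL.1 u)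
    have hres : ‖resAt y i A (τ u) u‖ ≤ ρ * Q.1 := norm_le_of_covers hρ hcov fun n hn => hf1 n hn u
    rw [LinearIsometryEquiv.coe_toLinearIsometry, norm_sub_smul_eq y i A hr, mul_comm]
    exact mul_le_mul_of_nonneg_right hres hr.le
  · have hr : 0 < nearestDist y i := nearestDist_pos_of_adj hy (hL.1 u)
    have hres : ‖resAt y i A m ((u : E3) + v)‖ ≤ ρ * Q.2.1 :=
      norm_le_of_covers hρ hcov fun n hn => hf2 n hn u v huv m ⟨hmi, hb⟩
    rw [LinearIsometryEquiv.coe_toLinearIsometry, norm_sub_smul_eq y i A hr, mul_comm]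
    exact mul_le_mul_of_nonneg_right hres hr.le

/-! ## 5. The entry side: ungauged fits from the hand lane, and the ONE re-gauging step -/

/-- The trivial gauge (no condition): `GFitAt Pat D noGauge` is the UNGAUGED directional fit. -/
def noGauge (Pat : Finset E3) : (↥Pat → E3) → Prop := fun _ => True

/-! `CapAprioriAt Kq K θ Pat` is lens-5 g31's (landed by hand-1 as `…TwoShellRigidityLadder.CapAprioriAt`, p824145; opened above):
caps a priori within `Kq·θ·nn_i` of `nn_i·A(u+v)` whenever the dozen is within `K·θ·nn_i` of `nn_i·A(Pat)`; discharged BY NAME for both patterns in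
`…TwoShellRigidityLadderCap` (p824270: `Kq = 54 + 2K` from `OctaCellAt 18`, and the trilateration value `Kq = 2(K+2+θ) + (K+2+θ)²θ`). -/

/-- **The hand lane's `R(K) ∧ CapApriori(Kq)` IS an ungauged directional entry** with tuple `(K, Kq, 2K, Kq + K)·θ`, for any probe set of
vectors of norm `≤ 1`. [folklore: `⟪n, x⟫ ≤ ‖x‖`, triangle inequality] -/
theorem gEntryAt_noGauge_of_coarse {Pat : Finset E3} {D : List E3} {K Kq θ : ℝ} (hD : ∀ n ∈ D, ‖n‖ ≤ 1)
    (hR : CoarseCappedRigidityAt K θ Pat) (hQ : CapAprioriAt Kq K θ Pat) :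
    GEntryAt Pat D (noGauge Pat) θ (K * θ, Kq * θ, 2 * K * θ, (Kq + K) * θ) := by
  intro N y i τ hy hsep hL hC
  obtain ⟨A₀, hA₀⟩ := hR N y i τ hy hsep hL hC
  have hcap := hQ N y i τ hy hsep hL hC A₀ hA₀
  set A : E3 ≃ₗᵢ[ℝ] E3 := A₀.toLinearIsometryEquiv rfl with hA_def
  have hAA : ∀ z, A z = A₀ z := fun z => rfl
  have hdir : ∀ n ∈ D, ∀ v : E3, ∀ b : ℝ, ‖v‖ ≤ b → ⟪n, v⟫ ≤ b := by
    intro n hn v b hv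
    calc ⟪n, v⟫ ≤ ‖n‖ * ‖v‖ := real_inner_le_norm _ _
      _ ≤ 1 * ‖v‖ := mul_le_mul_of_nonneg_right (hD n hn) (norm_nonneg _)
      _ ≤ b := by rw [one_mul]; exact hv
  rcases isEmpty_or_nonempty ↥Pat with hE | ⟨⟨u₀⟩⟩
  · exact ⟨A, fun _ _ u => (hE.false u).elim, fun _ _ u => (hE.false u).elim, fun _ _ u => (hE.false u).elim,
      fun _ _ u => (hE.false u).elim, trivial⟩
  have hr : 0 < nearestDist y i := nearestDist_pos_of_adj hy (hL.1 u₀)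
  set r := nearestDist y i with hr_def
  -- residual norms from the Euclidean bounds
  have hres : ∀ (j : Fin N) (z : E3) (b : ℝ), ‖(y j - y i) - r • A₀ z‖ ≤ b * r → ‖resAt y i A j z‖ ≤ b := by
    intro j z b hb
    rw [← hAA, norm_sub_smul_eq y i A hr j z] at hb
    exact le_of_mul_le_mul_left (by linarith [hb]) hr
  have hx : ∀ u : ↥Pat, ‖resAt y i A (τ u) u‖ ≤ K * θ := fun u => hres _ _ _ (hA₀ u)
  have hc : ∀ u v : ↥Pat, dist (u : E3) (v : E3) = Real.sqrt 2 → ∀ m, IsCap θ y i τ u v m →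
      ‖resAt y i A m ((u : E3) + v)‖ ≤ Kq * θ := by
    intro u v huv m hm
    exact hres _ _ _ (hcap u v m huv hm.1 hm.2)
  refine ⟨A, ?_, ?_, ?_, ?_, trivial⟩
  · intro n hn u; exact hdir n hn _ _ (hx u)
  · intro n hn u v huv m hm; exact hdir n hn _ _ (hc u v huv m hm)
  · intro n hn u w _
    refine hdir n hn _ _ ((norm_sub_le _ _).trans ?_)
    linarith [hx u, hx w]
  · intro n hn u v huv m hm w _
    refine hdir n hn _ _ ((norm_sub_le _ _).trans ?_)
    linarith [hc u v huv m hm, hx w]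

/-- Same with probes of norm `≤ L` (e.g. the rational-pairing list `probes26Q`, `L = √2`): entry tuple scaled by `L`. [folklore] -/
theorem gEntryAt_noGauge_of_coarse' {Pat : Finset E3} {D : List E3} {K Kq θ L : ℝ} (hL : 0 ≤ L) (hD : ∀ n ∈ D, ‖n‖ ≤ L)
    (hR : CoarseCappedRigidityAt K θ Pat) (hQ : CapAprioriAt Kq K θ Pat) :
    GEntryAt Pat D (noGauge Pat) θ (L * (K * θ), L * (Kq * θ), L * (2 * K * θ), L * ((Kq + K) * θ)) := by
  intro N y i τ hy hsep hL0 hC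
  obtain ⟨A₀, hA₀⟩ := hR N y i τ hy hsep hL0 hC
  have hcap := hQ N y i τ hy hsep hL0 hC A₀ hA₀
  set A : E3 ≃ₗᵢ[ℝ] E3 := A₀.toLinearIsometryEquiv rfl with hA_def
  have hAA : ∀ z, A z = A₀ z := fun z => rfl
  have hdir : ∀ n ∈ D, ∀ v : E3, ∀ b : ℝ, ‖v‖ ≤ b → ⟪n, v⟫ ≤ L * b := by
    intro n hn v b hv
    calc ⟪n, v⟫ ≤ ‖n‖ * ‖v‖ := real_inner_le_norm _ _
      _ ≤ L * ‖v‖ := mul_le_mul_of_nonneg_right (hD n hn) (norm_nonneg _)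
      _ ≤ L * b := mul_le_mul_of_nonneg_left hv hL
  rcases isEmpty_or_nonempty ↥Pat with hE | ⟨⟨u₀⟩⟩
  · exact ⟨A, fun _ _ u => (hE.false u).elim, fun _ _ u => (hE.false u).elim, fun _ _ u => (hE.false u).elim,
      fun _ _ u => (hE.false u).elim, trivial⟩
  have hr : 0 < nearestDist y i := nearestDist_pos_of_adj hy (hL0.1 u₀)
  set r := nearestDist y i with hr_def
  have hres : ∀ (j : Fin N) (z : E3) (b : ℝ), ‖(y j - y i) - r • A₀ z‖ ≤ b * r → ‖resAt y i A j z‖ ≤ b := by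
    intro j z b hb
    rw [← hAA, norm_sub_smul_eq y i A hr j z] at hb
    exact le_of_mul_le_mul_left (by linarith [hb]) hr
  have hx : ∀ u : ↥Pat, ‖resAt y i A (τ u) u‖ ≤ K * θ := fun u => hres _ _ _ (hA₀ u)
  have hc : ∀ u v : ↥Pat, dist (u : E3) (v : E3) = Real.sqrt 2 → ∀ m, IsCap θ y i τ u v m →
      ‖resAt y i A m ((u : E3) + v)‖ ≤ Kq * θ := by
    intro u v huv m hm
    exact hres _ _ _ (hcap u v m huv hm.1 hm.2)
  refine ⟨A, ?_, ?_, ?_, ?_, trivial⟩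
  · intro n hn u; exact hdir n hn _ _ (hx u)
  · intro n hn u v huv m hm; exact hdir n hn _ _ (hc u v huv m hm)
  · intro n hn u w _
    refine hdir n hn _ _ ((norm_sub_le _ _).trans ?_)
    linarith [hx u, hx w]
  · intro n hn u v huv m hm w _
    refine hdir n hn _ _ ((norm_sub_le _ _).trans ?_)
    linarith [hc u v huv m hm, hx w]

/-- **`RegaugeAt(Pat, D, Γ, θ, P → Q)` — THE ONE RE-GAUGING STEP**: an UNGAUGED `D`-fit of tolerance `P` (any isometry) yields a `Γ`-GAUGED
`D`-fit of tolerance `Q` for some (other) isometry.  [The ONLY step of the ladder that moves the isometry — hence the only place a rotation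
(second-order remainder of `exp [ω]×`) is ever estimated; done ONCE, not per rung (critic row 452 (A)).  ATTACKABLE·M: crude constants from
`GaugeFix` below (`regaugeAt_of_gaugeFix`, proved); sharp constants = one LP with objectives `n·(w_u − ω(w)×u)` + the rotation remainder.] -/
def RegaugeAt (Pat : Finset E3) (D : List E3) (Γ : (↥Pat → E3) → Prop) (θ : ℝ) (P Q : ℝ × ℝ × ℝ × ℝ) : Prop :=
  ∀ (N : ℕ) (y : Fin N → E3) (i : Fin N) (τ : ↥Pat → Fin N), Function.Injective y →
    (∀ a b : Fin N, a ≠ b → (7 : ℝ) / 10 ≤ dist (y a) (y b)) → LinkIso θ Pat y i τ → Capped θ Pat y i τ →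
      ∀ A : E3 ≃ₗᵢ[ℝ] E3, GFitAt Pat D (noGauge Pat) θ P y i τ A → ∃ A' : E3 ≃ₗᵢ[ℝ] E3, GFitAt Pat D Γ θ Q y i τ A'

/-- Ungauged entry + re-gauging = gauged entry. [folklore] -/
theorem gEntryAt_of_regauge {Pat : Finset E3} {D : List E3} {Γ : (↥Pat → E3) → Prop} {θ : ℝ} {P Q : ℝ × ℝ × ℝ × ℝ}
    (hU : GEntryAt Pat D (noGauge Pat) θ P) (hG : RegaugeAt Pat D Γ θ P Q) : GEntryAt Pat D Γ θ Q := by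
  intro N y i τ hy hsep hL hC
  obtain ⟨A, hA⟩ := hU N y i τ hy hsep hL hC
  exact hG N y i τ hy hsep hL hC A hA

/-- **`GaugeFix(Pat, Γ, κ)` — existence of a gauged frame near any frame** (pure finite-dimensional analysis, configuration-free):
for every dozen `p : Pat → E3` within `a` of an isometric image `A(Pat)` there is an isometry `A'` whose frame residuals `A'⁻¹ p − id` satisfy
the gauge `Γ`, with `‖A' z − A z‖ ≤ κ·a·‖z‖`.  [ANALYTIC · ATTACKABLE·M · Mathlib-only.  For `Γ = lsGauge` and both kissing patterns it holds
with `κ = √6`: minimise `Σ_u ‖p_u − B u‖²` over the coset `A·SO(3)` (compact); the first-order condition in the direction `[ω]×` is exactly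
`Σ_u u × (B⁻¹p_u − u) = 0`; and `Σ_u u uᵀ = 4·I` (fcc AND hcp) turns `Σ‖(B − A)u‖² ≤ 48a²` into `32 sin²(φ/2) ≤ 48 a²`, i.e.
`‖(B − A)z‖ ≤ 2 sin(φ/2)‖z‖ ≤ √6·a·‖z‖`.] -/
def GaugeFix (Pat : Finset E3) (Γ : (↥Pat → E3) → Prop) (κ : ℝ) : Prop :=
  ∀ (p : ↥Pat → E3) (A : E3 ≃ₗᵢ[ℝ] E3) (a : ℝ), (∀ u : ↥Pat, ‖p u - A u‖ ≤ a) →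
    ∃ A' : E3 ≃ₗᵢ[ℝ] E3, Γ (fun u => A'.symm (p u) - u) ∧ ∀ z : E3, ‖A' z - A z‖ ≤ κ * a * ‖z‖

/-- Pattern geometry: a square diagonal `u + v` has norm `√2`. [folklore] -/
theorem norm_add_eq_sqrt_two {Pat : Finset E3} (h1 : ∀ z ∈ Pat, ‖z‖ = 1) {u v : ↥Pat}
    (huv : dist (u : E3) (v : E3) = Real.sqrt 2) : ‖(u : E3) + v‖ = Real.sqrt 2 := by
  have hu := h1 u u.2
  have hv := h1 v v.2
  have h2 : (0 : ℝ) ≤ 2 := by norm_num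
  have huv' : ‖(u : E3) - v‖ ^ 2 = 2 := by rw [← dist_eq_norm, huv, Real.sq_sqrt h2]
  rw [norm_sub_sq_real, hu, hv] at huv'
  have hsq : ‖(u : E3) + v‖ ^ 2 = 2 := by rw [norm_add_sq_real, hu, hv]; linarith
  rw [← Real.sqrt_sq (norm_nonneg ((u : E3) + v)), hsq]

/-- **`GaugeFix ⟹ Regauge` with explicit (crude) constants**: from an ungauged `D`-fit `(a, aq, b, bq)` (covering constant `ρ` turns it into
Euclidean residuals `ρ·(…)`), `GaugeFix κ` moves the frame by `≤ κρa·‖z‖` and the new, GAUGED residuals are within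
`((1+κ)ρa, ρ·aq + √2·κρa, ρb + κρa, ρ·bq + κρa)` — directionally for every probe of norm `≤ 1`. [folklore: triangle inequality] -/
theorem regaugeAt_of_gaugeFix {Pat : Finset E3} {D : List E3} {Γ : (↥Pat → E3) → Prop} {θ ρ κ : ℝ} {P : ℝ × ℝ × ℝ × ℝ}
    (h1 : ∀ z ∈ Pat, ‖z‖ = 1) (hD : ∀ n ∈ D, ‖n‖ ≤ 1) (hρ : 0 ≤ ρ) (hcov : Covers D ρ)
    (hfix : GaugeFix Pat Γ κ) :
    RegaugeAt Pat D Γ θ P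
      ((1 + κ) * (ρ * P.1), ρ * P.2.1 + Real.sqrt 2 * (κ * (ρ * P.1)), ρ * P.2.2.1 + κ * (ρ * P.1), ρ * P.2.2.2 + κ * (ρ * P.1)) := by
  intro N y i τ hy hsep hL hC A hA
  obtain ⟨hf1, hf2, hf3, hf4, -⟩ := hA
  rcases isEmpty_or_nonempty ↥Pat with hE | ⟨⟨u₀⟩⟩
  · obtain ⟨A', hΓ, -⟩ := hfix (fun u => (hE.false u).elim) A 0 (fun u => (hE.false u).elim)
    refine ⟨A', fun _ _ u => (hE.false u).elim, fun _ _ u => (hE.false u).elim, fun _ _ u => (hE.false u).elim,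
      fun _ _ u => (hE.false u).elim, ?_⟩
    convert hΓ using 1
  have hr : 0 < nearestDist y i := nearestDist_pos_of_adj hy (hL.1 u₀)
  set r := nearestDist y i with hr_def
  set a : ℝ := ρ * P.1 with ha_def
  -- lab-frame normalised positions
  set p : Fin N → E3 := fun j => r⁻¹ • (y j - y i) with hp_def
  have hres_eq : ∀ (B : E3 ≃ₗᵢ[ℝ] E3) (j : Fin N) (z : E3), resAt y i B j z = B.symm (p j) - z := fun B j z => rfl
  have hnorm_res : ∀ (B : E3 ≃ₗᵢ[ℝ] E3) (j : Fin N) (z : E3), ‖resAt y i B j z‖ = ‖p j - B z‖ := by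
    intro B j z
    rw [hres_eq, ← B.norm_map, map_sub, LinearIsometryEquiv.apply_symm_apply]
  have hnorm_res₂ : ∀ (B : E3 ≃ₗᵢ[ℝ] E3) (j k : Fin N) (z z' : E3),
      ‖resAt y i B j z - resAt y i B k z'‖ = ‖(p j - p k) - B (z - z')‖ := by
    intro B j k z z'
    rw [hres_eq, hres_eq, ← B.norm_map, map_sub, map_sub, map_sub, LinearIsometryEquiv.apply_symm_apply,
      LinearIsometryEquiv.apply_symm_apply, map_sub]
    congr 1; abel
  -- Euclidean residuals of the input fit
  have hxa : ∀ u : ↥Pat, ‖p (τ u) - A u‖ ≤ a := by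
    intro u; rw [← hnorm_res]; exact norm_le_of_covers hρ hcov fun n hn => hf1 n hn u
  obtain ⟨A', hΓ, hclose⟩ := hfix (fun u => p (τ u)) A a hxa
  have hdir : ∀ n ∈ D, ∀ v : E3, ∀ b : ℝ, ‖v‖ ≤ b → ⟪n, v⟫ ≤ b := by
    intro n hn v b hv
    calc ⟪n, v⟫ ≤ ‖n‖ * ‖v‖ := real_inner_le_norm _ _
      _ ≤ 1 * ‖v‖ := mul_le_mul_of_nonneg_right (hD n hn) (norm_nonneg _)
      _ ≤ b := by rw [one_mul]; exact hv
  -- moving the frame costs `κ a ‖z‖`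
  have hmove : ∀ (q : E3) (z : E3) (b : ℝ), ‖q - A z‖ ≤ b → ‖q - A' z‖ ≤ b + κ * a * ‖z‖ := by
    intro q z b hb
    calc ‖q - A' z‖ = ‖(q - A z) - (A' z - A z)‖ := by congr 1; abel
      _ ≤ ‖q - A z‖ + ‖A' z - A z‖ := norm_sub_le _ _
      _ ≤ b + κ * a * ‖z‖ := add_le_add hb (hclose z)
  refine ⟨A', ?_, ?_, ?_, ?_, hΓ⟩
  · intro n hn u
    refine hdir n hn _ _ ?_
    rw [hnorm_res]
    have := hmove (p (τ u)) u a (hxa u)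
    rw [h1 u u.2, mul_one] at this
    linarith
  · intro n hn u v huv m hm
    refine hdir n hn _ _ ?_
    rw [hnorm_res]
    have hb : ‖p m - A ((u : E3) + v)‖ ≤ ρ * P.2.1 := by
      rw [← hnorm_res]; exact norm_le_of_covers hρ hcov fun n hn => hf2 n hn u v huv m hm
    have := hmove (p m) ((u : E3) + v) _ hb
    rw [norm_add_eq_sqrt_two h1 huv] at this
    linarith
  · intro n hn u w huw
    refine hdir n hn _ _ ?_
    rw [hnorm_res₂]
    have hb : ‖(p (τ u) - p (τ w)) - A ((u : E3) - w)‖ ≤ ρ * P.2.2.1 := by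
      rw [← hnorm_res₂]; exact norm_le_of_covers hρ hcov fun n hn => hf3 n hn u w huw
    have := hmove _ ((u : E3) - w) _ hb
    have hnuw : ‖(u : E3) - w‖ = 1 := by rw [← dist_eq_norm, huw]
    rw [hnuw, mul_one] at this
    linarith
  · intro n hn u v huv m hm w hw
    refine hdir n hn _ _ ?_
    rw [hnorm_res₂]
    have hb : ‖(p m - p (τ w)) - A ((u : E3) + v - w)‖ ≤ ρ * P.2.2.2 := by
      rw [← hnorm_res₂]; exact norm_le_of_covers hρ hcov fun n hn => hf4 n hn u v huv m hm w hw
    have := hmove _ ((u : E3) + v - w) _ hb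
    rw [norm_capRef_eq_one h1 huv hw, mul_one] at this
    linarith

end Summit.AtomisticToContinuum.Crystallization.Theorems.FrustratedLawDichotomyTwoShellRigidityGaugedLadder
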